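import Summits.SmoothPoincare4.SmoothPoincare4.Theorems.SoloInformedSplittingNoGo

/-!
# SoloInformedSplittingNoGoShear — the splitting no-go survives `l`-shears of `m` (solo-informed s70)

HOME `work/s70/notes.md` §5, `paper/doors-for-M0.md` §10 (claims C625, C627, C656, C657).
`SoloInformedSplittingNoGo` certifies the arithmetic of the no-go "no diffeomorphism
`S⁴ = X₁₈ → X₂₀ = 𝔐₀` preserves HKM's splitting 3-torus" under the prose hypothesis (P2) that
`Diff(Y × S¹)` acts on `H₁(∂) = ⟨m, l, s⟩` through `B = {m ↦ ε₁ m + k s, l ↦ ε₂ l, s ↦ ε₃ s}` — i.e.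
that every isometry of the one-cusped hyperbolic manifold `Y = Σ(2,3,7) ∖ νK̃` acts on the cusp
by signs ("no `l`-shear of `m`").  This file removes that input: allow the larger family

  `B' = {m ↦ ε₁ m + i l + k s, l ↦ ε₂ l, s ↦ ε₃ s}`  (`i ∈ ℤ` an arbitrary `l`-shear of `m`),

which contains the image of `Diff(Y × S¹)` using only Mostow–Prasad (every automorphism of `π₁ Y`
is an isometry, preserves the cusp and the canonical longitude `± l`), `H¹(Y; ℤ) = ℤ` (`l ↦ 0`) and
`Aut(π₁ Y × ℤ) = {(x, t) ↦ (α x, φ x + ε t)}` (centre `ℤ` characteristic, `π₁ Y` centreless).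

* `bMLS' i k ε₁ ε₂ ε₃`, `bFam' j i k … := gInv j * bMLS' … * gMat j` (`B'` and `B'^g`), closed form
  `bFam'_explicit` (its `μ`-row is `(k + i, ε₃ - j k - j i - ε₂, ε₂)`), `bFam'_zero : bFam' j 0 = bFam j`.
* `splitting_nogo_shear`: for `n, ε₁, ε₃` odd and ALL `j, i, k, ε₂`, neither `delta n * bFam' …` nor
  `bFam' … * delta n` satisfies `ANec` (the `μ`-row forces `k + i = 0`; then, mod 2, the two
  evenness conditions of `PreservesQ` on the torus block contradict each other).
  `splitting_nogo_shear_HKM`: the instance `n = 1`, `j = 9`, signs `± 1`.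

So, given Lemma P (i),(ii) and HKM eq. (3) as transcribed in `SoloInformedSplittingNoGo` (P3)
(`δ` = one Dehn twist of `𝕋̃` about `C̃₁ ↔ μ̃(K)`, i.e. `C₂ ↦ C₂ ± C₁`; re-read at page level in s70:
arXiv:2402.11706 p. 7 eq. (3), p. 8 Claim 2.3), the no-go needs no information about `Isom(Y)`.
Remark (prose, work/s70 §5): for the OTHER twist `C₁ ↦ C₁ ± C₂` the obstruction would not survive an
odd `l`-shear — the page-level reading of which curve HKM twist about is therefore load-bearing.
-/

namespace Summit.SmoothPoincare4.SmoothPoincare4.Theorems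

open Matrix

/-- The family `B'` in `(m, l, s)`-coordinates: `m ↦ ε₁ m + i l + k s`, `l ↦ ε₂ l`, `s ↦ ε₃ s`
(columns = images). -/
def bMLS' (i k ε₁ ε₂ ε₃ : ℤ) : Matrix (Fin 3) (Fin 3) ℤ :=
  !![ε₁, 0, 0; i, ε₂, 0; k, 0, ε₃]

/-- `B'^g`: the family `B'` transported to `(C₁, C₂, μ)`-coordinates by HKM's gluing `g`. -/
def bFam' (j i k ε₁ ε₂ ε₃ : ℤ) : Matrix (Fin 3) (Fin 3) ℤ :=
  gInv j * bMLS' i k ε₁ ε₂ ε₃ * gMat j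

/-- Without `l`-shear, `B'` is the family `B` of `SoloInformedSplittingNoGo`. -/
theorem bMLS'_zero (k ε₁ ε₂ ε₃ : ℤ) : bMLS' 0 k ε₁ ε₂ ε₃ = bMLS k ε₁ ε₂ ε₃ := by
  ext a b
  fin_cases a <;> fin_cases b <;> rfl

/-- Without `l`-shear, `B'^g = B^g`. -/
theorem bFam'_zero (j k ε₁ ε₂ ε₃ : ℤ) : bFam' j 0 k ε₁ ε₂ ε₃ = bFam j k ε₁ ε₂ ε₃ := by
  rw [bFam', bMLS'_zero]
  rfl

/-- Closed form of `B'^g`; row `2` (the `μ`-components of the images of `C₁, C₂, μ`) is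
`(k + i, ε₃ - j k - j i - ε₂, ε₂)`. -/
theorem bFam'_explicit (j i k ε₁ ε₂ ε₃ : ℤ) :
    bFam' j i k ε₁ ε₂ ε₃ =
      !![ε₁ + j * k, j * (ε₃ - j * k) - j * ε₁, 0;
         k, ε₃ - j * k, 0;
         k + i, ε₃ - j * k - j * i - ε₂, ε₂] := by
  ext a b
  fin_cases a <;> fin_cases b <;>
    simp [bFam', bMLS', gMat, gInv, Matrix.mul_apply, Fin.sum_univ_three] <;> ring

/-- Entries of `δⁿ ∘ b'` used below. -/
theorem delta_mul_bFam'_entries (n j i k ε₁ ε₂ ε₃ : ℤ) :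
    (delta n * bFam' j i k ε₁ ε₂ ε₃) 2 0 = k + i ∧
    (delta n * bFam' j i k ε₁ ε₂ ε₃) 0 0 = ε₁ + j * k + n * k ∧
    (delta n * bFam' j i k ε₁ ε₂ ε₃) 1 0 = k ∧
    (delta n * bFam' j i k ε₁ ε₂ ε₃) 0 1 = j * (ε₃ - j * k) - j * ε₁ + n * (ε₃ - j * k) ∧
    (delta n * bFam' j i k ε₁ ε₂ ε₃) 1 1 = ε₃ - j * k := by
  rw [bFam'_explicit]
  refine ⟨?_, ?_, ?_, ?_, ?_⟩ <;> simp [delta, Matrix.mul_apply, Fin.sum_univ_three]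

/-- Entries of `b' ∘ δⁿ` used below. -/
theorem bFam'_mul_delta_entries (n j i k ε₁ ε₂ ε₃ : ℤ) :
    (bFam' j i k ε₁ ε₂ ε₃ * delta n) 2 0 = k + i ∧
    (bFam' j i k ε₁ ε₂ ε₃ * delta n) 0 0 = ε₁ + j * k ∧
    (bFam' j i k ε₁ ε₂ ε₃ * delta n) 1 0 = k ∧
    (bFam' j i k ε₁ ε₂ ε₃ * delta n) 0 1 = n * (ε₁ + j * k) + (j * (ε₃ - j * k) - j * ε₁) ∧
    (bFam' j i k ε₁ ε₂ ε₃ * delta n) 1 1 = n * k + (ε₃ - j * k) := by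
  rw [bFam'_explicit]
  (refine ⟨?_, ?_, ?_, ?_, ?_⟩ <;> simp [delta, Matrix.mul_apply, Fin.sum_univ_three]) <;> ring

/-- Parity transfer: an even integer is `0` in `ZMod 2`. -/
theorem intCast_zmod_two_of_even {x : ℤ} (h : Even x) : (x : ZMod 2) = 0 := by
  obtain ⟨r, rfl⟩ := h
  have h2 : (2 : ZMod 2) = 0 := by decide
  have : ((r + r : ℤ) : ZMod 2) = 2 * (r : ZMod 2) := by push_cast; ring
  rw [this, h2, zero_mul]

/-- Parity transfer: an odd integer is `1` in `ZMod 2`. -/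
theorem intCast_zmod_two_of_odd {x : ℤ} (h : Odd x) : (x : ZMod 2) = 1 := by
  obtain ⟨r, rfl⟩ := h
  have h2 : (2 : ZMod 2) = 0 := by decide
  push_cast
  rw [h2, zero_mul, zero_add]

/-- **Splitting no-go with `l`-shears (arithmetic core of C656).**  For `n` odd (HKM's `δ = delta 1`)
and `ε₁, ε₃` odd, and for ALL `j, i, k, ε₂`: neither `δⁿ ∘ b'` nor `b' ∘ δⁿ` (`b' ∈ B'^g`) satisfies
the necessary conditions `ANec` for lying in the image of `π₀ Diff(S⁴ ∖ ν𝕋)`.  Hence `δ ∉ A · B'^g`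
and `δ ∉ B'^g · A`: no hypothesis on how `Isom(Y)` acts on the cusp is needed. -/
theorem splitting_nogo_shear (n j i k ε₁ ε₂ ε₃ : ℤ) (hn : Odd n) (h₁ : Odd ε₁) (h₃ : Odd ε₃) :
    ¬ ANec (delta n * bFam' j i k ε₁ ε₂ ε₃) ∧ ¬ ANec (bFam' j i k ε₁ ε₂ ε₃ * delta n) := by
  have cn := intCast_zmod_two_of_odd hn
  have c1 := intCast_zmod_two_of_odd h₁
  have c3 := intCast_zmod_two_of_odd h₃
  constructor
  · obtain ⟨r20, r00, r10, r01, r11⟩ := delta_mul_bFam'_entries n j i k ε₁ ε₂ ε₃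
    rintro ⟨⟨hk, -⟩, hq1, hq2, -⟩
    rw [r20] at hk
    rw [r00, r10] at hq1
    rw [r01, r11] at hq2
    have hkc := congrArg (Int.cast : ℤ → ZMod 2) hk
    have a1 := intCast_zmod_two_of_even hq1
    have a2 := intCast_zmod_two_of_even hq2
    push_cast at hkc a1 a2
    simp only [cn, c1, c3] at a1 a2
    generalize (j : ZMod 2) = a at hkc a1 a2
    generalize (i : ZMod 2) = b at hkc a1 a2
    generalize (k : ZMod 2) = c at hkc a1 a2
    revert a b c
    decide
  · obtain ⟨r20, r00, r10, r01, r11⟩ := bFam'_mul_delta_entries n j i k ε₁ ε₂ ε₃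
    rintro ⟨⟨hk, -⟩, hq1, hq2, -⟩
    rw [r20] at hk
    rw [r00, r10] at hq1
    rw [r01, r11] at hq2
    have hkc := congrArg (Int.cast : ℤ → ZMod 2) hk
    have a1 := intCast_zmod_two_of_even hq1
    have a2 := intCast_zmod_two_of_even hq2
    push_cast at hkc a1 a2
    simp only [cn, c1, c3] at a1 a2
    generalize (j : ZMod 2) = a at hkc a1 a2
    generalize (i : ZMod 2) = b at hkc a1 a2
    generalize (k : ZMod 2) = c at hkc a1 a2
    revert a b c
    decide

/-- The HKM instance: `δ = delta 1`, `j = 9` (`X₁₈ = S⁴`), signs `± 1`, any `l`-shear `i`. -/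
theorem splitting_nogo_shear_HKM (i k ε₁ ε₂ ε₃ : ℤ)
    (h₁ : ε₁ = 1 ∨ ε₁ = -1) (h₃ : ε₃ = 1 ∨ ε₃ = -1) :
    ¬ ANec (delta 1 * bFam' 9 i k ε₁ ε₂ ε₃) ∧ ¬ ANec (bFam' 9 i k ε₁ ε₂ ε₃ * delta 1) := by
  apply splitting_nogo_shear 1 9 i k ε₁ ε₂ ε₃ odd_one
  · rcases h₁ with h | h <;> subst h <;> decide
  · rcases h₃ with h | h <;> subst h <;> decide

end Summit.SmoothPoincare4.SmoothPoincare4.Theorems
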